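import Literature.MathematicalPhysics.QuantumFieldTheory.Balaban1983to89.B1Eq324BenfattoSect5PerBox
import Literature.MathematicalPhysics.QuantumFieldTheory.Balaban1983to89.B1Eq324BenfattoSect5Eq515
import Literature.MathematicalPhysics.QuantumFieldTheory.Balaban1983to89.B1Eq324BenfattoSect5ChiToOneOnData
import HarnessLib

/-!
# `Balaban1983to89.B1Eq324BenfattoSect5PerBoxOnData` — [BenfattoEtAl1978] §5 pp. 157–159: THE PER-BOX RELATION (5.30)→(5.33)/(5.36)
# ON PRINT'S OBJECTS — the conditioned free field `P̄(dz_□|z_{Γ₁})`, the box small-field event `χ_b^□`, the pieces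
# `Ψ′₁, Ψ″₁, Ψ₂, Ψ₃` of the boxes line — with the volume input (5.19), the a-priori sizes (5.15) i)/(5.24) and the χ-removal
# (5.29)₁ DISCHARGED; the two Appendix-D cluster inputs displayed per colouring

statement-level skeleton of published theorems with citation tags; proofs where landed; nothing here is a claim about the
Yang–Mills mass gap

WHY THIS MODULE (cell `pub-ymgap`, seat `dag-n08-b`, node N08 «first missing estimate» lane; layer 1.5 of the assembly of
`B1Eq324BenfattoLemma.BasicLemmaPrinted`, between the generic per-box algebra `B1Eq324BenfattoSect5PerBox` (layer 1) and the
product over boxes / Markov reassembly `B1Eq324BenfattoSect5Eq515` (+ its sequel, layer 2)).  `…Sect5PerBox.abs_log_integral_perBox_le_of_colourings`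
is the per-box relation of (5.30)→(5.33)/(5.36) on an abstract probability space with five kinds of displayed inputs: measurability,
a.e. sizes `K`/`ε` of the cut slots, the volume `∫χ ≥ e^{−W}`, and per colouring the (5.29)-bound and the (5.31)-closeness of the
χ-WEIGHTED conditional joint truncated expectations.  This file instantiates it on print's objects — `P̄(dz_□|z_Γ) =
condField d α β Γ ξ` with small-field conditioning data, the box event `χ_b^□ = 𝟙{|z_Δ| ≤ b(1+d(Δ,I)), Δ ⊂ □′∪Γ₂(□)}`, the pieces
`Ψ′₁, Ψ″₁, Ψ₂, Ψ₃` of the boxes line (`…Sect5Eq524`) — and DISCHARGES every input that is a tree theorem today: the volume by (5.19)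
(`…Sect5Cumulant.eq519_condField`, App. C Lemma 2), the sizes by (5.15) i)/(5.24) in LOCAL form (§2: `|z_Δ| ≤ b` is only known for
`Δ ⊂ J ∩ □` — on `□′∪Γ₂(□)` from the event, on `Γ₁(□) ⊆ Γ` because there the field IS the datum a.s., `…Sect5Eq515.condField_ae_eqOn`),
and the χ-removal inside every colouring by (5.29)₁ on data (`…Sect5ChiToOneOnData.abs_ursellOf_tupleSum_mul_sub_le_of_smallFieldData`,
for which §1 writes each piece as ONE tuple-class sum).  What remains displayed, per colouring `f` of `k ≤ t` slots, are the two
Appendix-D inputs on the UNCUT conditioned slots: `|𝓔^T_{P̄}(f)| ≤ δ₂₉(k)` for `f` using `Ψ″₁` and `Ψ₂` ((5.29)₂), and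
`|𝓔^T_{P̄}(f) − 𝓔^T_{P̂₀}(f)| ≤ δ₃₁(k)` for `f` using `Ψ″₁`, avoiding `Ψ₂` ((5.31) «(error)») — in exactly the tuple-class currency of
the sibling seat's `…Sect5TupleClusters` (`abs_ursellOf_tupleSums_condField_le_exp_of_separated` / `…_sub_P0_le`), which supplies them
with the corridor geometry of `…Sect5LegGeometry`.

THE PRINTED TEXT: (5.23)–(5.36), pp. 157–159, quoted in full in `…Sect5JointCumulants` / `…Sect5PerBox` (desk renders
`bcg_p157_s3.png`–`bcg_p159_s3.png`); (5.14)/(5.15) p. 155 in `…Sect5Eq515`; (5.19) p. 156 in `…Sect5Cumulant`.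

DICTIONARY.  `□ = box L m` (side `L = b²`), `□′∪Γ₂(□) = shrink L m w`, `Γ₁(□) = frame1`, `Γ₂ = frame2`, `Γ₃ = frame3 L w v`, `Γ₄ = frame4 L w v`
(`…Sect5Boxes`, `…Sect5Eq524`; print: `w = b^{3/2}`, `v = w/2`); `P̄(dz_□|z_{Γ₁}) = condField d α β Γ ξ` for a conditioning set `Γ ⊇ Γ₁(□)`
with datum `|ξ_c| ≤ γb(1 + d(Δ_c, I))` (print's `χ^{Γ₁}_{γb}`); `χ_b^□ = 𝟙_S`, `S = smallFieldOn (shrink L m w) I b` ((5.14), the `≦` version);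
`Ψ′₁ = psi1p`, `Ψ″₁ = psi1pp`, `Ψ₂ = psi2`, `Ψ₃ = H′^{(l)} = psi3`, `Ψ_□ = psiBox`; the three slots as tuple-class sums `T 0, T 1, T 2`
(§1); `K = 4s₁Ab^DL^d` (covers `|Ψ_□|, |Ψ₁|, |Ψ′₁|, |Ψ″₁|, |Ψ₂|, |Ψ′₁+Ψ₂|` on the event; print: `s₂Ab^{D+2d}`), `ε = s₁Ab^De^{−(ϰ/4)v}L^d`
((5.24); print `s₁Ab^{D+2d}e^{−(ϰ/8)b^{3/2}}`), `W = 3|□′∪Γ₂(□)|e^{−b²/4}` ((5.19)), `c_k` = the constant of `…ChiToOneOnData` at `k` slots.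

WHAT IS PROVED (theorems only; no definition, no named fact, no `sorry`; axioms standard).
* §1 `psi1p_eq_tupleSum`, `psi1pp_eq_tupleSum`, `psi2_eq_tupleSum` — each piece is ONE tuple-class sum `Σ_pΣ_{Δ∈T p}Σ_n term`
  (classes `tuplesIn Γ₄ ∪ crossT Γ₄ Γ₃`, `(tuplesIn □′∖tuplesIn Γ₄) ∪ (crossT □′ Γ₃ ∖ crossT Γ₄ Γ₃)`, `crossT Γ₁ Γ₂ ∪ tuplesIn Γ₂`).
* §2 LOCAL SIZES ON THE BOX (`|z_Δ| ≤ b` on `J ∩ □` only, via the cut configuration `z·𝟙_□`): `abs_hamiltonian_le_box` (`R ⊆ □`),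
  `abs_interaction_le_box` (`R, S ⊆ □`, from `…Sect5Eq534.abs_interaction_le_of_sep` at separation 0), `abs_psi1p_le_box` (`2s₁Ab^DL^d`),
  `abs_psi1_le_box`, `abs_psi1pp_le_box` (`4s₁Ab^DL^d`), `abs_psi2_le_box`, `psi3_congr_eqOn` (`Ψ₃` reads `□` only), `abs_psi3_le_box`.
* §3 ★★ **`perBox_condField`** — THE PER-BOX RELATION ON PRINT'S OBJECTS as a package: for `lhs = ∫_S e^{Ψ_□} dP̄`, `rhs = ∫_S e^{Ψ′₁+Ψ₂} dP̄`,
  `E = Σ_{k≤t}(Σ_{f uses Ψ″₁, avoids Ψ₂} 𝓔^T_{P̂₀}(f))/k!` and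
  `Err = 2·2^{C(t+1,2)}K^{t+1}/(t+1)! + e^{2K}W + Σ_{k≤t}(3^k s_k εK^{k−1} + 3^k(c_k + δ₂₉(k)) + 3^k(c_k + δ₃₁(k)))/k!`:
  `0 < lhs`, `0 < rhs`, `|log lhs − log rhs − E| ≤ Err`, `e^{E−Err}·rhs ≤ lhs`, `lhs ≤ e^{E+Err}·rhs` — the last two being the
  factors print multiplies over `□ ∩ J ≠ ∅` in (5.30)/(5.32) (lower) and (5.36) (upper).

HONEST SCOPE / NOT HERE.  (i) The two Appendix-D inputs `δ₂₉`, `δ₃₁` are DISPLAYED per colouring (currency of `…Sect5TupleClusters`);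
their values — print's `e^{−ϰ̃b^{3/2}}` from `dist(□′∖Γ₄(□), complement of □′) ≥ v` and the (C.7)+(C.2) ε's at depth — are the
sibling seats' (`…Sect5TupleClusters`, `…Sect5LegGeometry`), not restated here; the decay-weighted coefficient MASS bound `M` of the three
classes is displayed too (a lattice-sum bookkeeping of the boxes line).  (ii) AS PROVED vs AS PRINTED: constants as in the parents
(`K = 4s₁Ab^DL^d` for print's `s₂Ab^{D+2d}`, the kernel remainder `2^{C(t+1,2)}`, the χ-removal rate `(min 1 (2|□|e^{−b²/4}))^{1/(2k)}` for
print's `e^{−b²/4}`); the coefficient bound is taken GLOBAL (`|A^n_Δ| ≤ A` for all indices, as in `…Sect5Eq524.abs_psi3_le`).  (iii) NOT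
here: the product over boxes, (5.34)/(5.35), the pavements, `errTerm`, `b*`; the free-side re-summation (`…Sect5FreeCumulants`).
`BasicLemmaPrinted` stays OPEN.  NOT summit progress; count-neutral for N08; nothing of [Balaban1985UV3] (41)/(47)/(5) is asserted.
-/

open MeasureTheory ProbabilityTheory Finset
open scoped BigOperators Nat

namespace Literature.MathematicalPhysics.QuantumFieldTheory.Balaban1983to89.B1Eq324BenfattoSect5PerBoxOnData

open _root_.MeasureTheory _root_.ProbabilityTheory
open Literature.Probability.LatticeModels (setPartitions ursellOf)
open Literature.MathematicalPhysics.QuantumFieldTheory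
open Literature.MathematicalPhysics.QuantumFieldTheory.Balaban1983to89.B1Eq324BenfattoLemma
open Literature.MathematicalPhysics.QuantumFieldTheory.Balaban1983to89.B1Eq324BenfattoSect5Boxes
open Literature.MathematicalPhysics.QuantumFieldTheory.Balaban1983to89.B1Eq324BenfattoSect5Eq511
open Literature.MathematicalPhysics.QuantumFieldTheory.Balaban1983to89.B1Eq324BenfattoSect5Eq524
open Literature.MathematicalPhysics.QuantumFieldTheory.Balaban1983to89.B1Eq324BenfattoSect5Eq534
open Literature.MathematicalPhysics.QuantumFieldTheory.Balaban1983to89.B1Eq324BenfattoSect5Eq515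
open Literature.MathematicalPhysics.QuantumFieldTheory.Balaban1983to89.B1Eq324BenfattoMarkov (isProbabilityMeasure_condField)
open Literature.MathematicalPhysics.QuantumFieldTheory.Balaban1983to89.B1Eq324BenfattoSect5Cumulant (eq519_condField)
open Literature.MathematicalPhysics.QuantumFieldTheory.Balaban1983to89.B1Eq324GaussianMomentLeaf (momentConst one_le_momentConst)

variable {d : ℕ}

/-! ## §1  The three pieces `Ψ′₁, Ψ″₁, Ψ₂` as tuple-class sums (the slot currency of `…ChiToOneOnData` / `…PolyClusters`) -/

section Classes

variable {s D : ℕ} {κ : ℝ} {a : Coef d} {J : Finset (B1Eq324BenfattoLemma.Site d)} {L w v : ℕ}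
  {m : B1Eq324BenfattoLemma.Site d}

/-- A region class and a crossing class anchored at that region are disjoint index sets. [folklore] -/
private theorem disjoint_tuplesIn_crossT {p : ℕ} (R S : Finset (B1Eq324BenfattoLemma.Site d)) :
    Disjoint (tuplesIn J p R) (crossT J p R S) :=
  Finset.disjoint_left.2 fun Δ hΔ hΔ' => by
    rw [crossT, Finset.mem_sdiff] at hΔ'
    exact hΔ'.2 (Finset.mem_union_left _ hΔ)

/-- **Ψ′₁ = H_{Γ₄(□)} + H_{Γ₄(□),Γ₃(□)} (5.27) as ONE tuple-class sum**: the class `tuplesIn Γ₄ ∪ crossT Γ₄ Γ₃`.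
[cite: BenfattoEtAl1978, (5.27) p.157] -/
theorem psi1p_eq_tupleSum (hJ : CoefSupportedIn a J) (z : B1Eq324BenfattoLemma.Site d → ℝ) :
    psi1p s D κ a L w v m z = ∑ p ∈ Finset.Icc 1 s,
      ∑ Δ ∈ tuplesIn J p (frame4 L w v m) ∪ crossT J p (frame4 L w v m) (frame3 L w v m),
        ∑ n ∈ admissible p D, term κ a z p Δ n := by
  have hd43 : Disjoint (frame4 L w v m) (frame3 L w v m) :=
    Finset.disjoint_of_subset_left (frame4_subset_core L w v m) (disjoint_core_frame3 L w v m)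
  rw [psi1p, hamiltonian_eq_sum_tuplesIn hJ, interaction_eq_sum_crossT hJ hd43, ← Finset.sum_add_distrib]
  refine Finset.sum_congr rfl fun p _ => ?_
  rw [Finset.sum_union (disjoint_tuplesIn_crossT _ _)]

/-- **Ψ″₁ = Ψ₁ − Ψ′₁ (5.27) as ONE tuple-class sum**: the class
`(tuplesIn □′ ∖ tuplesIn Γ₄) ∪ (crossT □′ Γ₃ ∖ crossT Γ₄ Γ₃)` (`B1Eq324BenfattoSect5Eq524.psi1pp_eq_sum`); every member has a
tessera in `□′∖Γ₄(□)` (`…Eq524.exists_mem_core_sdiff_frame4`). [cite: BenfattoEtAl1978, (5.27) p.157] -/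
theorem psi1pp_eq_tupleSum (hJ : CoefSupportedIn a J) (z : B1Eq324BenfattoLemma.Site d → ℝ) :
    psi1pp s D κ a L w v m z = ∑ p ∈ Finset.Icc 1 s,
      ∑ Δ ∈ (tuplesIn J p (core L w m) \ tuplesIn J p (frame4 L w v m)) ∪
          (crossT J p (core L w m) (frame3 L w v m) \ crossT J p (frame4 L w v m) (frame3 L w v m)),
        ∑ n ∈ admissible p D, term κ a z p Δ n := by
  rw [psi1pp_eq_sum hJ]
  refine Finset.sum_congr rfl fun p _ => ?_
  rw [Finset.sum_union]
  exact Finset.disjoint_of_subset_left Finset.sdiff_subset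
    (Finset.disjoint_of_subset_right Finset.sdiff_subset (disjoint_tuplesIn_crossT _ _))

/-- **Ψ₂ = H_{Γ₁(□),Γ₂(□)} + H_{Γ₂(□)} (5.23) as ONE tuple-class sum**: the class `crossT Γ₁ Γ₂ ∪ tuplesIn Γ₂`.
[cite: BenfattoEtAl1978, (5.23) p.157] -/
theorem psi2_eq_tupleSum (hJ : CoefSupportedIn a J) (z : B1Eq324BenfattoLemma.Site d → ℝ) :
    psi2 s D κ a L w m z = ∑ p ∈ Finset.Icc 1 s,
      ∑ Δ ∈ crossT J p (frame1 L w m) (frame2 L w m) ∪ tuplesIn J p (frame2 L w m),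
        ∑ n ∈ admissible p D, term κ a z p Δ n := by
  have hd12 : Disjoint (frame1 L w m) (frame2 L w m) := (disjoint_frame2_frame1 L w m).symm
  rw [psi2, hamiltonian_eq_sum_tuplesIn hJ, interaction_eq_sum_crossT hJ hd12, ← Finset.sum_add_distrib]
  refine Finset.sum_congr rfl fun p _ => ?_
  rw [Finset.sum_union]
  refine Finset.disjoint_left.2 fun Δ hΔ hΔ' => ?_
  rw [crossT, Finset.mem_sdiff] at hΔ
  exact hΔ.2 (Finset.mem_union_right _ hΔ')

end Classes

/-! ## §2  The a-priori sizes of the pieces ON THE BOX («(5.15) i)», (5.24)), local forms: `|z_Δ| ≤ b` only for `Δ ⊂ J ∩ □` -/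

section LocalBounds

variable {s D : ℕ} {κ : ℝ} {a : Coef d} {J : Finset (B1Eq324BenfattoLemma.Site d)} {L w v : ℕ}
  {m : B1Eq324BenfattoLemma.Site d}

/-- `H_{R,S}` reads the configuration only on `R ∪ S`. [cite: BenfattoEtAl1978, (5.6) p.154] -/
private theorem interaction_congr_eqOn (R S : Finset (B1Eq324BenfattoLemma.Site d)) {z z' : B1Eq324BenfattoLemma.Site d → ℝ}
    (h : ∀ x ∈ R ∪ S, z x = z' x) : interaction s D κ a R S z = interaction s D κ a R S z' := by
  rw [interaction, interaction, hamiltonian_congr_eqOn (R ∪ S) h,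
    hamiltonian_congr_eqOn R (fun x hx => h x (Finset.mem_union_left _ hx)),
    hamiltonian_congr_eqOn S (fun x hx => h x (Finset.mem_union_right _ hx))]

/-- A region inside the tessera has at most `L^d` sites. [cite: BenfattoEtAl1978, (5.7) p.154] -/
private theorem card_le_pow_of_subset_box {R : Finset (B1Eq324BenfattoLemma.Site d)} (hR : R ⊆ box L m) :
    (R.card : ℝ) ≤ (L : ℝ) ^ d := by
  have h : R.card ≤ L ^ d := (Finset.card_le_card hR).trans (by rw [← shrink_zero]; exact card_shrink_le L m 0)
  exact_mod_cast h

/-- The cut configuration `z·𝟙_□` is bounded by `b` on all of `J` when `z` is on `J ∩ □` (`b ≥ 0`). [folklore] -/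
private theorem abs_cut_le {z : B1Eq324BenfattoLemma.Site d → ℝ} {b : ℝ} (hb : 0 ≤ b)
    (hz : ∀ x ∈ J, x ∈ box L m → |z x| ≤ b) (x : B1Eq324BenfattoLemma.Site d) (hx : x ∈ J) :
    |(fun y => if y ∈ box L m then z y else 0) x| ≤ b := by
  by_cases hxR : x ∈ box L m
  · simp only [if_pos hxR]
    exact hz x hx hxR
  · simp only [if_neg hxR, abs_zero]
    exact hb

/-- **Local size of a region Hamiltonian inside the tessera**: `R ⊆ □`, `|z_Δ| ≤ b` on `J ∩ □` ⟹ `|H_R(z)| ≤ s₁Ab^D·L^d`.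
[cite: BenfattoEtAl1978, (5.15) p.155] -/
theorem abs_hamiltonian_le_box (hκ : 0 < κ) (hJ : CoefSupportedIn a J) {A : ℝ} (hA0 : 0 ≤ A)
    (hA : ∀ p ∈ Finset.Icc 1 s, ∀ (Δ : Fin p → B1Eq324BenfattoLemma.Site d), (∀ i, Δ i ∈ J) →
      ∀ n ∈ admissible p D, |a p Δ n| ≤ A)
    {R : Finset (B1Eq324BenfattoLemma.Site d)} (hR : R ⊆ box L m) {z : B1Eq324BenfattoLemma.Site d → ℝ} {b : ℝ}
    (hb : 1 ≤ b) (hz : ∀ x ∈ J, x ∈ box L m → |z x| ≤ b) :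
    |hamiltonian s D κ a R z| ≤ s1Const s D d κ * A * b ^ D * (L : ℝ) ^ d := by
  have hs : 0 ≤ s1Const s D d κ * A * b ^ D := by
    have := s1Const_nonneg hκ s D d
    positivity
  exact (abs_hamiltonian_le_local hκ hJ hA0 hA R hb fun x hx hxR => hz x hx (hR hxR)).trans
    (mul_le_mul_of_nonneg_left (card_le_pow_of_subset_box hR) hs)

/-- **Local size of an interaction inside the tessera**: `R, S ⊆ □` disjoint, `|z_Δ| ≤ b` on `J ∩ □` ⟹ `|H_{R,S}(z)| ≤ s₁Ab^D·L^d`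
(`B1Eq324BenfattoSect5Eq534.abs_interaction_le_of_sep` at separation `0` on the cut configuration). [cite: BenfattoEtAl1978, (5.15) p.155] -/
theorem abs_interaction_le_box (hκ : 0 < κ) (hJ : CoefSupportedIn a J) {A : ℝ} (hA0 : 0 ≤ A)
    (hA : ∀ p ∈ Finset.Icc 1 s, ∀ (Δ : Fin p → B1Eq324BenfattoLemma.Site d), (∀ i, Δ i ∈ J) →
      ∀ n ∈ admissible p D, |a p Δ n| ≤ A)
    {R S : Finset (B1Eq324BenfattoLemma.Site d)} (hRS : Disjoint R S) (hR : R ⊆ box L m) (hS : S ⊆ box L m)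
    {z : B1Eq324BenfattoLemma.Site d → ℝ} {b : ℝ} (hb : 1 ≤ b) (hz : ∀ x ∈ J, x ∈ box L m → |z x| ≤ b) :
    |interaction s D κ a R S z| ≤ s1Const s D d κ * A * b ^ D * (L : ℝ) ^ d := by
  classical
  set z' : B1Eq324BenfattoLemma.Site d → ℝ := fun y => if y ∈ box L m then z y else 0 with hz'
  have hRS' : R ∪ S ⊆ box L m := Finset.union_subset hR hS
  rw [interaction_congr_eqOn R S (z' := z') (fun x hx => by simp only [hz', if_pos (hRS' hx)])]
  have h := abs_interaction_le_of_sep hκ hJ hA0 hA hRS (ρ := 0) (fun x _ y _ => by unfold cubeDist; positivity) hb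
    (abs_cut_le (zero_le_one.trans hb) hz) (s := s) (D := D) (z := z')
  rw [mul_zero, neg_zero, Real.exp_zero, mul_one] at h
  have hs : 0 ≤ s1Const s D d κ * A * b ^ D := by
    have := s1Const_nonneg hκ s D d
    positivity
  exact h.trans (mul_le_mul_of_nonneg_left (card_le_pow_of_subset_box hRS') hs)

/-- `Γ₃(□) ⊆ □`. [cite: BenfattoEtAl1978, (5.23) p.157] -/
private theorem frame3_subset_box (hv : v ≤ w) : frame3 L w v m ⊆ box L m :=
  (frame3_subset_frame2 L hv m).trans (by rw [frame2]; exact Finset.sdiff_subset.trans (shrink_subset_box L m w))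

/-- `□′ ⊆ □`. [cite: BenfattoEtAl1978, (5.7) p.154] -/
private theorem core_subset_box : core L w m ⊆ box L m := by
  rw [core]; exact shrink_subset_box L m (2 * w)

/-- `Γ₄(□) ⊆ □`. [cite: BenfattoEtAl1978, (5.27) p.157] -/
private theorem frame4_subset_box : frame4 L w v m ⊆ box L m := (frame4_subset_core L w v m).trans core_subset_box

/-- `Γ₂(□) ⊆ □`. [cite: BenfattoEtAl1978, (5.7) p.154] -/
private theorem frame2_subset_box : frame2 L w m ⊆ box L m := by
  rw [frame2]; exact Finset.sdiff_subset.trans (shrink_subset_box L m w)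

/-- `Γ₁(□) ⊆ □`. [cite: BenfattoEtAl1978, (5.7) p.154] -/
private theorem frame1_subset_box : frame1 L w m ⊆ box L m := by
  rw [frame1]; exact Finset.sdiff_subset

/-- **`|Ψ′₁| ≤ 2s₁Ab^DL^d` on the box.** [cite: BenfattoEtAl1978, (5.15) p.155, (5.27) p.157] -/
theorem abs_psi1p_le_box (hκ : 0 < κ) (hJ : CoefSupportedIn a J) {A : ℝ} (hA0 : 0 ≤ A)
    (hA : ∀ p ∈ Finset.Icc 1 s, ∀ (Δ : Fin p → B1Eq324BenfattoLemma.Site d), (∀ i, Δ i ∈ J) →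
      ∀ n ∈ admissible p D, |a p Δ n| ≤ A)
    (hv : v ≤ w) {z : B1Eq324BenfattoLemma.Site d → ℝ} {b : ℝ} (hb : 1 ≤ b) (hz : ∀ x ∈ J, x ∈ box L m → |z x| ≤ b) :
    |psi1p s D κ a L w v m z| ≤ 2 * (s1Const s D d κ * A * b ^ D * (L : ℝ) ^ d) := by
  have hd43 : Disjoint (frame4 L w v m) (frame3 L w v m) :=
    Finset.disjoint_of_subset_left (frame4_subset_core L w v m) (disjoint_core_frame3 L w v m)
  rw [psi1p]
  have h1 := abs_hamiltonian_le_box hκ hJ hA0 hA (frame4_subset_box (w := w) (v := v)) hb hz (s := s) (D := D)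
  have h2 := abs_interaction_le_box hκ hJ hA0 hA hd43 frame4_subset_box (frame3_subset_box hv) hb hz (s := s) (D := D)
  calc _ ≤ |hamiltonian s D κ a (frame4 L w v m) z| + |interaction s D κ a (frame4 L w v m) (frame3 L w v m) z| :=
        abs_add_le _ _
    _ ≤ _ := by linarith

/-- **`|Ψ₁| ≤ 2s₁Ab^DL^d` on the box** (`Ψ₁ = H_{□′} + H_{□′,Γ₃(□)}`). [cite: BenfattoEtAl1978, (5.15) p.155, (5.23) p.157] -/
theorem abs_psi1_le_box (hκ : 0 < κ) (hJ : CoefSupportedIn a J) {A : ℝ} (hA0 : 0 ≤ A)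
    (hA : ∀ p ∈ Finset.Icc 1 s, ∀ (Δ : Fin p → B1Eq324BenfattoLemma.Site d), (∀ i, Δ i ∈ J) →
      ∀ n ∈ admissible p D, |a p Δ n| ≤ A)
    (hv : v ≤ w) {z : B1Eq324BenfattoLemma.Site d → ℝ} {b : ℝ} (hb : 1 ≤ b) (hz : ∀ x ∈ J, x ∈ box L m → |z x| ≤ b) :
    |psi1 s D κ a L w v m z| ≤ 2 * (s1Const s D d κ * A * b ^ D * (L : ℝ) ^ d) := by
  rw [psi1]
  have h1 := abs_hamiltonian_le_box hκ hJ hA0 hA (core_subset_box (w := w)) hb hz (s := s) (D := D)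
  have h2 := abs_interaction_le_box hκ hJ hA0 hA (disjoint_core_frame3 L w v m) core_subset_box (frame3_subset_box hv) hb hz
    (s := s) (D := D)
  calc _ ≤ |hamiltonian s D κ a (core L w m) z| + |interaction s D κ a (core L w m) (frame3 L w v m) z| := abs_add_le _ _
    _ ≤ _ := by linarith

/-- **`|Ψ″₁| ≤ 4s₁Ab^DL^d` on the box** (`Ψ″₁ = Ψ₁ − Ψ′₁`). [cite: BenfattoEtAl1978, (5.15) p.155, (5.27) p.157] -/
theorem abs_psi1pp_le_box (hκ : 0 < κ) (hJ : CoefSupportedIn a J) {A : ℝ} (hA0 : 0 ≤ A)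
    (hA : ∀ p ∈ Finset.Icc 1 s, ∀ (Δ : Fin p → B1Eq324BenfattoLemma.Site d), (∀ i, Δ i ∈ J) →
      ∀ n ∈ admissible p D, |a p Δ n| ≤ A)
    (hv : v ≤ w) {z : B1Eq324BenfattoLemma.Site d → ℝ} {b : ℝ} (hb : 1 ≤ b) (hz : ∀ x ∈ J, x ∈ box L m → |z x| ≤ b) :
    |psi1pp s D κ a L w v m z| ≤ 4 * (s1Const s D d κ * A * b ^ D * (L : ℝ) ^ d) := by
  rw [psi1pp]
  have h1 := abs_psi1_le_box hκ hJ hA0 hA hv hb hz (s := s) (D := D) (L := L) (m := m)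
  have h2 := abs_psi1p_le_box hκ hJ hA0 hA hv hb hz (s := s) (D := D) (L := L) (m := m)
  calc _ ≤ |psi1 s D κ a L w v m z| + |psi1p s D κ a L w v m z| := abs_sub _ _
    _ ≤ _ := by linarith

/-- **`|Ψ₂| ≤ 2s₁Ab^DL^d` on the box** (`Ψ₂ = H_{Γ₁(□),Γ₂(□)} + H_{Γ₂(□)}`). [cite: BenfattoEtAl1978, (5.15) p.155, (5.23) p.157] -/
theorem abs_psi2_le_box (hκ : 0 < κ) (hJ : CoefSupportedIn a J) {A : ℝ} (hA0 : 0 ≤ A)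
    (hA : ∀ p ∈ Finset.Icc 1 s, ∀ (Δ : Fin p → B1Eq324BenfattoLemma.Site d), (∀ i, Δ i ∈ J) →
      ∀ n ∈ admissible p D, |a p Δ n| ≤ A)
    {z : B1Eq324BenfattoLemma.Site d → ℝ} {b : ℝ} (hb : 1 ≤ b) (hz : ∀ x ∈ J, x ∈ box L m → |z x| ≤ b) :
    |psi2 s D κ a L w m z| ≤ 2 * (s1Const s D d κ * A * b ^ D * (L : ℝ) ^ d) := by
  rw [psi2]
  have h1 := abs_hamiltonian_le_box hκ hJ hA0 hA (frame2_subset_box (w := w)) hb hz (s := s) (D := D)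
  have h2 := abs_interaction_le_box hκ hJ hA0 hA (disjoint_frame2_frame1 L w m).symm frame1_subset_box frame2_subset_box hb hz
    (s := s) (D := D)
  calc _ ≤ |interaction s D κ a (frame1 L w m) (frame2 L w m) z| + |hamiltonian s D κ a (frame2 L w m) z| := abs_add_le _ _
    _ ≤ _ := by linarith

/-- `Ψ₃ = Ψ_□ − Ψ₁ − Ψ₂` reads the configuration only on `□`. [cite: BenfattoEtAl1978, (5.23) p.157] -/
theorem psi3_congr_eqOn (hv : v ≤ w) {z z' : B1Eq324BenfattoLemma.Site d → ℝ} (h : ∀ x ∈ box L m, z x = z' x) :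
    psi3 s D κ a L w v m z = psi3 s D κ a L w v m z' := by
  rw [psi3, psi3, psi1, psi1, psi2, psi2, psiBox_congr_eqOn L w m h,
    hamiltonian_congr_eqOn (core L w m) (fun x hx => h x (core_subset_box hx)),
    hamiltonian_congr_eqOn (frame2 L w m) (fun x hx => h x (frame2_subset_box hx)),
    interaction_congr_eqOn (core L w m) (frame3 L w v m)
      (fun x hx => h x (Finset.union_subset core_subset_box (frame3_subset_box hv) hx)),
    interaction_congr_eqOn (frame1 L w m) (frame2 L w m)
      (fun x hx => h x (Finset.union_subset frame1_subset_box frame2_subset_box hx))]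

/-- **(5.24) on the box, local form**: `|Ψ₃(z)| ≤ s₁Ab^D e^{−(ϰ/4)v} L^d` when `|z_Δ| ≤ b` on `J ∩ □` (global coefficient bound as in
`B1Eq324BenfattoSect5Eq524.abs_psi3_le'`). [cite: BenfattoEtAl1978, (5.24) p.157] -/
theorem abs_psi3_le_box (hκ : 0 < κ) (hJ : CoefSupportedIn a J) {A : ℝ}
    (hA : ∀ (p : ℕ) (Δ : Fin p → B1Eq324BenfattoLemma.Site d) (n : Fin p → ℕ), |a p Δ n| ≤ A)
    (hv : v ≤ w) {z : B1Eq324BenfattoLemma.Site d → ℝ} {b : ℝ} (hb : 1 ≤ b) (hz : ∀ x ∈ J, x ∈ box L m → |z x| ≤ b) :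
    |psi3 s D κ a L w v m z| ≤ s1Const s D d κ * A * b ^ D * Real.exp (-(κ / 4 * v)) * (L : ℝ) ^ d := by
  classical
  set z' : B1Eq324BenfattoLemma.Site d → ℝ := fun y => if y ∈ box L m then z y else 0 with hz'
  rw [psi3_congr_eqOn hv (z' := z') (fun x hx => by simp only [hz', if_pos hx])]
  exact abs_psi3_le' hκ hJ hA hv hb (abs_cut_le (zero_le_one.trans hb) hz)

end LocalBounds

/-! ## §3  The per-box relation ON PRINT'S OBJECTS: `P̄(dz_□|z_Γ) = condField`, `χ_b^□`, `Ψ′₁, Ψ″₁, Ψ₂, Ψ₃` -/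

section OnData

variable {α β : ℝ} {s D : ℕ} {κ : ℝ} {a : Coef d} {J I : Finset (B1Eq324BenfattoLemma.Site d)} {L w v : ℕ}
  {m : B1Eq324BenfattoLemma.Site d} {Γ : Finset (B1Eq324BenfattoLemma.Site d)} {ξ : B1Eq324BenfattoLemma.Site d → ℝ}
  {γ b A M : ℝ}

/-- A tuple-class sum is measurable (a finite sum of monomials times constants). [folklore] -/
private theorem measurable_tupleSum (T : (p : ℕ) → Finset (Fin p → J)) :
    Measurable fun z : B1Eq324BenfattoLemma.Site d → ℝ =>
      ∑ p ∈ Finset.Icc 1 s, ∑ Δ ∈ T p, ∑ n ∈ admissible p D, term κ a z p Δ n := by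
  refine Finset.measurable_sum _ fun p _ => Finset.measurable_sum _ fun Δ _ => Finset.measurable_sum _ fun n _ => ?_
  unfold term
  exact measurable_const.mul (Finset.measurable_prod _ fun i _ => (measurable_pi_apply _).pow_const _)

/-- `Ψ₃` is measurable. [folklore] -/
private theorem measurable_psi3 : Measurable fun z : B1Eq324BenfattoLemma.Site d → ℝ => psi3 s D κ a L w v m z := by
  have h1 : Measurable fun z : B1Eq324BenfattoLemma.Site d → ℝ => psi1 s D κ a L w v m z := by
    unfold psi1 interaction
    exact ((measurable_hamiltonian _).add
      (((measurable_hamiltonian _).sub (measurable_hamiltonian _)).sub (measurable_hamiltonian _)))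
  have h2 : Measurable fun z : B1Eq324BenfattoLemma.Site d → ℝ => psi2 s D κ a L w m z := by
    unfold psi2 interaction
    exact ((((measurable_hamiltonian _).sub (measurable_hamiltonian _)).sub (measurable_hamiltonian _)).add
      (measurable_hamiltonian _))
  unfold psi3
  exact ((measurable_psiBox L w m).sub h1).sub h2

/-- Positivity of a cut exponential moment: `0 < ∫ χe^{X} dμ` when `∫χ ≥ e^{−W}` and `|X| ≤ K` a.e. (the lower a-priori
bracket `e^{−K}∫χ ≤ ∫χe^{X}`). [folklore] -/
private theorem integral_mul_exp_pos {Ω : Type*} {mΩ : MeasurableSpace Ω} {μ : Measure Ω} [IsProbabilityMeasure μ]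
    {χ X : Ω → ℝ} {K W : ℝ} (hχm : Measurable χ) (hχ0 : ∀ ω, 0 ≤ χ ω) (hχ1 : ∀ ω, χ ω ≤ 1)
    (hXm : AEMeasurable X μ) (hXK : ∀ᵐ ω ∂μ, |X ω| ≤ K) (hW : Real.exp (-W) ≤ ∫ ω, χ ω ∂μ) :
    0 < ∫ ω, χ ω * Real.exp (X ω) ∂μ := by
  have hχInt : Integrable χ μ :=
    Integrable.mono' (integrable_const (1 : ℝ)) hχm.aestronglyMeasurable (ae_of_all _ fun ω => by
      rw [Real.norm_eq_abs, abs_of_nonneg (hχ0 ω)]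
      exact hχ1 ω)
  have heInt : Integrable (fun ω => Real.exp (X ω)) μ :=
    Integrable.mono' (integrable_const (Real.exp K))
      (Real.measurable_exp.comp_aemeasurable hXm).aestronglyMeasurable (hXK.mono fun ω hω => by
        rw [Real.norm_eq_abs, abs_of_pos (Real.exp_pos _)]
        exact Real.exp_le_exp.2 (abs_le.1 hω).2)
  have hχeInt : Integrable (fun ω => χ ω * Real.exp (X ω)) μ :=
    Integrable.mono' heInt (hχm.aestronglyMeasurable.mul
      (Real.measurable_exp.comp_aemeasurable hXm).aestronglyMeasurable) (ae_of_all _ fun ω => by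
      rw [Real.norm_eq_abs, abs_mul, abs_of_nonneg (hχ0 ω), abs_of_pos (Real.exp_pos _)]
      exact mul_le_of_le_one_left (Real.exp_pos _).le (hχ1 ω))
  have hlow : Real.exp (-K) * ∫ ω, χ ω ∂μ ≤ ∫ ω, χ ω * Real.exp (X ω) ∂μ := by
    rw [← integral_const_mul]
    refine integral_mono_ae (hχInt.const_mul _) hχeInt (hXK.mono fun ω hω => ?_)
    have h1 : Real.exp (-K) ≤ Real.exp (X ω) := Real.exp_le_exp.2 (abs_le.1 hω).1
    have h2 := hχ0 ω
    nlinarith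
  exact lt_of_lt_of_le (mul_pos (Real.exp_pos _) ((Real.exp_pos _).trans_le hW)) hlow

/-- **THE PER-BOX RELATION (5.30)→(5.33) / (5.36) ON PRINT'S OBJECTS.**  Setting: a tessera `□ = □_m` of side `L` with corridors of
width `w` and inner corridors of width `v ≤ w`; the conditioned free field `P̄ = P̂₀(dz | z̄ on Γ = ξ)` for a conditioning set
`Γ ⊇ Γ₁(□)` with SMALL-FIELD DATA `|ξ_c| ≤ γb(1 + d(Δ_c, I))` (`γ ≤ 1`, the App. C Lemma 2 side condition `γ(1+2d/α²) ≤ ½`, `E z_Δ² ≤ ½`);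
the box small-field event `S = {|z_Δ| ≤ b(1+d(Δ,I)), Δ ⊂ □′∪Γ₂(□)}` (print's `χ_b^□`, (5.14)); the pieces `Ψ′₁, Ψ″₁, Ψ₂` as the
tuple-class sums `T 0, T 1, T 2` (`psi1p/psi1pp/psi2_eq_tupleSum`) with decay-weighted coefficient masses `≤ M`, `Ψ₃ = H′^{(l)}`;
coefficients `|A| ≤ A` under the extension convention on `J ⊆ I`; `b ≥ 1`, `|□′∪Γ₂(□)|e^{−b²/4} ≤ 1/6`.  DISPLAYED INPUTS, per colouring
`f` of `k ≤ t` slots by the three pieces: (5.29)₂ `|𝓔^T_{P̄}(uncut slots of f)| ≤ δ₂₉(k)` for `f` using `Ψ″₁` and `Ψ₂`, and the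
(5.31) «(error)» `|𝓔^T_{P̄}(uncut f) − 𝓔^T_{P̂₀}(uncut f)| ≤ δ₃₁(k)` for `f` using `Ψ″₁` and avoiding `Ψ₂` (Appendix D + the corridor
geometry — the sibling seats' `…TupleClusters`).  CONCLUSION (a package, `lhs = ∫_S e^{Ψ_□} dP̄`, `rhs = ∫_S e^{Ψ′₁+Ψ₂} dP̄`,
`E = Σ_{k≤t} (Σ_{f uses Ψ″₁, avoids Ψ₂} 𝓔^T_{P̂₀}(f))/k!`): `0 < lhs`, `0 < rhs`, `|log lhs − log rhs − E| ≤ Err`, and the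
multiplicative forms `e^{E−Err}·rhs ≤ lhs ≤ e^{E+Err}·rhs` that (5.32)/(5.35) multiply over boxes, with `Err = 2·2^{C(t+1,2)}K^{t+1}/(t+1)! +
e^{2K}·3|□′∪Γ₂(□)|e^{−b²/4} + Σ_{k≤t}(3^k s_k εK^{k−1} + 3^k(c_k + δ₂₉(k)) + 3^k(c_k + δ₃₁(k)))/k!`, `K = 4s₁Ab^DL^d`,
`ε = s₁Ab^De^{−(ϰ/4)v}L^d` ((5.24)) and `c_k` the χ-removal constant of `…ChiToOneOnData` at order `k` — every analytic input of
`…Sect5PerBox.abs_log_integral_perBox_le_of_colourings` DISCHARGED on print's objects ((5.19) `eq519_condField`, (5.15) i) local sizes,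
(5.29)₁ `abs_ursellOf_tupleSum_mul_sub_le_of_smallFieldData`, `z = ξ` a.s. on `Γ` `condField_ae_eqOn`), except the two cluster inputs.
[cite: BenfattoEtAl1978, (5.30)–(5.33) pp.158–159, (5.36) p.159] -/
theorem perBox_condField (hα : 0 < α) (hβ : 0 < β) (hvar : freeCov d α β 0 0 ≤ 1 / 2)
    (hκ : 0 < κ) (hJ : CoefSupportedIn a J) (hJI : J ⊆ I) (hA0 : 0 ≤ A)
    (hA : ∀ (p : ℕ) (Δ : Fin p → B1Eq324BenfattoLemma.Site d) (n : Fin p → ℕ), |a p Δ n| ≤ A)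
    (hv : v ≤ w) (hb : 1 ≤ b) (hγ0 : 0 ≤ γ) (hγ1 : γ ≤ 1) (hγ : γ * (1 + 2 * d / α ^ 2) ≤ 1 / 2)
    (hΓ : frame1 L w m ⊆ Γ) (hξ : ∀ c ∈ Γ, |ξ c| ≤ γ * b * (1 + distToRegion I c))
    (hsmall : ((shrink L m w).card : ℝ) * Real.exp (-(b ^ 2 / 4)) ≤ 1 / 6)
    (T : Fin 3 → (p : ℕ) → Finset (Fin p → J))
    (hT0 : ∀ p, T 0 p = tuplesIn J p (frame4 L w v m) ∪ crossT J p (frame4 L w v m) (frame3 L w v m))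
    (hT1 : ∀ p, T 1 p = (tuplesIn J p (core L w m) \ tuplesIn J p (frame4 L w v m)) ∪
      (crossT J p (core L w m) (frame3 L w v m) \ crossT J p (frame4 L w v m) (frame3 L w v m)))
    (hT2 : ∀ p, T 2 p = crossT J p (frame1 L w m) (frame2 L w m) ∪ tuplesIn J p (frame2 L w m))
    (hM : ∀ c, ∑ p ∈ Finset.Icc 1 s, ∑ Δ ∈ T c p, ∑ n ∈ admissible p D,
      |a p (fun i => (Δ i : B1Eq324BenfattoLemma.Site d)) n| *
        Real.exp (-(κ / 2) * connLength fun i => (Δ i : B1Eq324BenfattoLemma.Site d)) ≤ M)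
    {t : ℕ} {δ₂₉ δ₃₁ : ℕ → ℝ} (hδ₂₉ : ∀ k, 0 ≤ δ₂₉ k) (hδ₃₁ : ∀ k, 0 ≤ δ₃₁ k)
    (h29 : ∀ k < t, ∀ f : Fin (k + 1) → Fin 3, (∃ j, f j = 1) → (∃ j, f j = 2) →
      |ursellOf (fun P : Finset (Fin (k + 1)) => ∫ z, ∏ j ∈ P,
          (∑ p ∈ Finset.Icc 1 s, ∑ Δ ∈ T (f j) p, ∑ n ∈ admissible p D, term κ a z p Δ n) ∂condField d α β Γ ξ) univ|
        ≤ δ₂₉ (k + 1))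
    (h31 : ∀ k < t, ∀ f : Fin (k + 1) → Fin 3, (∃ j, f j = 1) → (∀ j, f j ≠ 2) →
      |ursellOf (fun P : Finset (Fin (k + 1)) => ∫ z, ∏ j ∈ P,
            (∑ p ∈ Finset.Icc 1 s, ∑ Δ ∈ T (f j) p, ∑ n ∈ admissible p D, term κ a z p Δ n) ∂condField d α β Γ ξ) univ -
        ursellOf (fun P : Finset (Fin (k + 1)) => ∫ z, ∏ j ∈ P,
            (∑ p ∈ Finset.Icc 1 s, ∑ Δ ∈ T (f j) p, ∑ n ∈ admissible p D, term κ a z p Δ n) ∂P0 d α β) univ|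
        ≤ δ₃₁ (k + 1)) :
    let K : ℝ := 4 * (s1Const s D d κ * A * b ^ D * (L : ℝ) ^ d)
    let ε : ℝ := s1Const s D d κ * A * b ^ D * Real.exp (-(κ / 4 * v)) * (L : ℝ) ^ d
    let W : ℝ := 3 * (((shrink L m w).card : ℝ) * Real.exp (-(b ^ 2 / 4)))
    let cχ : ℕ → ℝ := fun k => 2 ^ k * ((∑ π ∈ setPartitions (univ : Finset (Fin k)), ((π.card - 1)! : ℝ)) *
        ((min 1 (2 * ((shrink L m w).card : ℝ) * Real.exp (-(b ^ 2 / 4)))) ^ ((2 * k : ℕ) : ℝ)⁻¹ *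
          ((1 + (1 + 2 * d / α ^ 2) * (γ * b)) ^ D * M * momentConst D (2 * k) (freeCov d α β 0 0).toNNReal) ^ k))
    let lhs : ℝ := ∫ z in smallFieldOn (shrink L m w : Set (B1Eq324BenfattoLemma.Site d)) I b,
          Real.exp (psiBox s D κ a L w m z) ∂condField d α β Γ ξ
    let rhs : ℝ := ∫ z in smallFieldOn (shrink L m w : Set (B1Eq324BenfattoLemma.Site d)) I b,
          Real.exp (psi1p s D κ a L w v m z + psi2 s D κ a L w m z) ∂condField d α β Γ ξ
    let E : ℝ := ∑ k ∈ Finset.range t,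
            (∑ f ∈ univ.filter (fun f : Fin (k + 1) → Fin 3 => (∃ j, f j = 1) ∧ ∀ j, f j ≠ 2),
              ursellOf (fun P : Finset (Fin (k + 1)) => ∫ z, ∏ j ∈ P,
                (∑ p ∈ Finset.Icc 1 s, ∑ Δ ∈ T (f j) p, ∑ n ∈ admissible p D, term κ a z p Δ n) ∂P0 d α β) univ)
              / (k + 1)!
    let Err : ℝ := 2 * (2 ^ ((t + 1).choose 2) * K ^ (t + 1) / (t + 1)!) + Real.exp (2 * K) * W
        + ∑ k ∈ Finset.range t,
            (3 ^ (k + 1) * ((∑ π ∈ setPartitions (univ : Finset (Fin (k + 1))), ((π.card - 1)! : ℝ)) * (ε * K ^ k))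
              + 3 ^ (k + 1) * (cχ (k + 1) + δ₂₉ (k + 1)) + 3 ^ (k + 1) * (cχ (k + 1) + δ₃₁ (k + 1))) / (k + 1)!
    0 < lhs ∧ 0 < rhs ∧ |Real.log lhs - Real.log rhs - E| ≤ Err ∧
      Real.exp (E - Err) * rhs ≤ lhs ∧ lhs ≤ Real.exp (E + Err) * rhs := by
  intro K ε W cχ lhs rhs E Err
  haveI := isProbabilityMeasure_condField (d := d) hα hβ Γ ξ
  -- abbreviations
  set P := condField d α β Γ ξ with hP
  set S : Set (B1Eq324BenfattoLemma.Site d → ℝ) := smallFieldOn (shrink L m w : Set (B1Eq324BenfattoLemma.Site d)) I b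
    with hS
  set Y : Fin 3 → (B1Eq324BenfattoLemma.Site d → ℝ) → ℝ :=
    fun c z => ∑ p ∈ Finset.Icc 1 s, ∑ Δ ∈ T c p, ∑ n ∈ admissible p D, term κ a z p Δ n with hY
  set χ : (B1Eq324BenfattoLemma.Site d → ℝ) → ℝ := S.indicator 1 with hχ
  set K₀ : ℝ := s1Const s D d κ * A * b ^ D * (L : ℝ) ^ d with hK₀
  have hK₀0 : 0 ≤ K₀ := by
    have := s1Const_nonneg hκ s D d
    positivity
  have hKdef : K = 4 * K₀ := rfl
  have hb0 : 0 < b := lt_of_lt_of_le one_pos hb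
  have hA' : ∀ p ∈ Finset.Icc 1 s, ∀ (Δ : Fin p → B1Eq324BenfattoLemma.Site d), (∀ i, Δ i ∈ J) →
      ∀ n ∈ admissible p D, |a p Δ n| ≤ A := fun p _ Δ _ n _ => hA p Δ n
  -- the event, the weight
  have hSm : MeasurableSet S := measurableSet_smallFieldOn _ I b
  have hχm : Measurable χ := measurable_one.indicator hSm
  have hχ0 : ∀ z, 0 ≤ χ z := fun z => Set.indicator_nonneg (fun _ _ => zero_le_one) z
  have hχ1 : ∀ z, χ z ≤ 1 := fun z => Set.indicator_le_self' (fun _ _ => zero_le_one) z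
  have hχ01 : ∀ z, χ z = 0 ∨ χ z = 1 := fun z => by
    by_cases h : z ∈ S
    · exact Or.inr (by simp [hχ, h])
    · exact Or.inl (by simp [hχ, h])
  have hχE : ∀ z : B1Eq324BenfattoLemma.Site d → ℝ,
      (∀ x ∈ shrink L m w, |z x| < b * (1 + distToRegion I x)) → χ z = 1 := by
    intro z hz
    have hzS : z ∈ S := fun x hx => (hz x (Finset.mem_coe.1 hx)).le
    simp [hχ, hzS]
  -- the pieces: identification with print's `Ψ′₁, Ψ″₁, Ψ₂`
  have hY0 : ∀ z, Y 0 z = psi1p s D κ a L w v m z := fun z => by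
    simp only [hY, hT0]; exact (psi1p_eq_tupleSum hJ z).symm
  have hY1 : ∀ z, Y 1 z = psi1pp s D κ a L w v m z := fun z => by
    simp only [hY, hT1]; exact (psi1pp_eq_tupleSum hJ z).symm
  have hY2 : ∀ z, Y 2 z = psi2 s D κ a L w m z := fun z => by
    simp only [hY, hT2]; exact (psi2_eq_tupleSum hJ z).symm
  have hsumΨ : ∀ z, Y 0 z + Y 1 z + Y 2 z + psi3 s D κ a L w v m z = psiBox s D κ a L w m z := fun z => by
    rw [hY0, hY1, hY2, psi1pp, psi3, psi1]
    ring
  have hsum02 : ∀ z, Y 0 z + Y 2 z = psi1p s D κ a L w v m z + psi2 s D κ a L w m z := fun z => by rw [hY0, hY2]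
  -- measurability
  have hYm : ∀ c, AEStronglyMeasurable (Y c) P := fun c => (measurable_tupleSum (T c)).aestronglyMeasurable
  have hDm : AEStronglyMeasurable (fun z => psi3 s D κ a L w v m z) P := measurable_psi3.aestronglyMeasurable
  -- a.s. on `Γ` the field IS the datum; on `S` the box coordinates of `J` are `≤ b`
  have hae := condField_ae_eqOn hα hβ Γ ξ
  have hzb : ∀ᵐ z ∂P, z ∈ S → ∀ x ∈ J, x ∈ box L m → |z x| ≤ b := by
    refine hae.mono fun z hz hzS x hxJ hxb => ?_
    by_cases hxs : x ∈ shrink L m w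
    · have h := hzS x (Finset.mem_coe.2 hxs)
      rwa [Literature.MathematicalPhysics.QuantumFieldTheory.Balaban1983to89.B1Eq324BenfattoSect5SlotMoments.distToRegion_eq_zero_of_mem
        (hJI hxJ), add_zero, mul_one] at h
    · have hxf : x ∈ frame1 L w m := by
        rw [frame1]
        exact Finset.mem_sdiff.2 ⟨hxb, hxs⟩
      rw [hz x (hΓ hxf)]
      have h := hξ x (hΓ hxf)
      rw [Literature.MathematicalPhysics.QuantumFieldTheory.Balaban1983to89.B1Eq324BenfattoSect5SlotMoments.distToRegion_eq_zero_of_mem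
        (hJI hxJ), add_zero, mul_one] at h
      exact h.trans (by nlinarith)
  -- the a.e. bounds of the cut slots
  have cut : ∀ {X : (B1Eq324BenfattoLemma.Site d → ℝ) → ℝ} {B : ℝ}, 0 ≤ B →
      (∀ z, (∀ x ∈ J, x ∈ box L m → |z x| ≤ b) → |X z| ≤ B) → ∀ᵐ z ∂P, |X z * χ z| ≤ B := by
    intro X B hB hX
    refine hzb.mono fun z hz => ?_
    by_cases h : z ∈ S
    · have : χ z = 1 := by simp [hχ, h]
      rw [this, mul_one]
      exact hX z (hz h)
    · have : χ z = 0 := by simp [hχ, h]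
      rw [this, mul_zero, abs_zero]
      exact hB
  have hK0 : 0 ≤ K := by rw [hKdef]; positivity
  have hYK : ∀ c, ∀ᵐ z ∂P, |Y c z * χ z| ≤ K := by
    intro c
    refine cut hK0 fun z hz => ?_
    fin_cases c
    · rw [show Y ⟨0, by norm_num⟩ z = psi1p s D κ a L w v m z from hY0 z]
      exact (abs_psi1p_le_box hκ hJ hA0 hA' hv hb hz).trans (by rw [hKdef]; nlinarith)
    · rw [show Y ⟨1, by norm_num⟩ z = psi1pp s D κ a L w v m z from hY1 z]
      exact (abs_psi1pp_le_box hκ hJ hA0 hA' hv hb hz).trans (le_of_eq hKdef.symm)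
    · rw [show Y ⟨2, by norm_num⟩ z = psi2 s D κ a L w m z from hY2 z]
      exact (abs_psi2_le_box hκ hJ hA0 hA' hb hz).trans (by rw [hKdef]; nlinarith)
  have h01K : ∀ᵐ z ∂P, |(Y 0 z + Y 1 z) * χ z| ≤ K := by
    refine cut hK0 fun z hz => ?_
    rw [hY0, hY1, psi1pp, add_sub_cancel]
    exact (abs_psi1_le_box hκ hJ hA0 hA' hv hb hz).trans (by rw [hKdef]; nlinarith)
  have h02K : ∀ᵐ z ∂P, |(Y 0 z + Y 2 z) * χ z| ≤ K := by
    refine cut hK0 fun z hz => ?_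
    rw [hY0, hY2]
    calc _ ≤ |psi1p s D κ a L w v m z| + |psi2 s D κ a L w m z| := abs_add_le _ _
      _ ≤ 2 * K₀ + 2 * K₀ := add_le_add (abs_psi1p_le_box hκ hJ hA0 hA' hv hb hz) (abs_psi2_le_box hκ hJ hA0 hA' hb hz)
      _ = K := by rw [hKdef]; ring
  have hΨK : ∀ᵐ z ∂P, |(Y 0 z + Y 1 z + Y 2 z + psi3 s D κ a L w v m z) * χ z| ≤ K := by
    refine cut hK0 fun z hz => ?_
    rw [hsumΨ]
    exact (abs_psiBox_le_local hκ hJ hA0 hA' hb hz).trans (by rw [hKdef]; nlinarith)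
  have hε0 : 0 ≤ ε := by
    show 0 ≤ s1Const s D d κ * A * b ^ D * Real.exp (-(κ / 4 * v)) * (L : ℝ) ^ d
    have := s1Const_nonneg hκ s D d
    positivity
  have hεK : ε ≤ K := by
    have h1 : Real.exp (-(κ / 4 * v)) ≤ 1 := Real.exp_le_one_iff.2 (by
      have : (0 : ℝ) ≤ κ / 4 * v := by positivity
      linarith)
    calc ε = K₀ * Real.exp (-(κ / 4 * v)) := by simp only [hK₀]; ring
      _ ≤ K₀ * 1 := mul_le_mul_of_nonneg_left h1 hK₀0
      _ ≤ K := by rw [hKdef]; linarith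
  have hDε : ∀ᵐ z ∂P, |psi3 s D κ a L w v m z * χ z| ≤ ε :=
    cut hε0 fun z hz => abs_psi3_le_box hκ hJ hA hv hb hz
  -- (5.19): the volume of the box event
  have hW : Real.exp (-W) ≤ ∫ z, χ z ∂P := by
    rw [hχ, integral_indicator_one hSm]
    have h519 := eq519_condField hα hβ hvar hb0 hγ0 hγ Γ I (shrink L m w) ξ hξ hsmall
    refine h519.trans (measureReal_mono (fun z hz x hx => (hz x (Finset.mem_coe.1 hx)).le) ?_)
    exact measure_ne_top _ _
  -- (5.29)₁ on data: removing χ from a colouring's joint cumulant, per colouring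
  have hcχ : ∀ k : ℕ, ∀ f : Fin (k + 1) → Fin 3,
      |ursellOf (fun P' : Finset (Fin (k + 1)) => ∫ z, ∏ j ∈ P', Y (f j) z * χ z ∂P) univ -
        ursellOf (fun P' : Finset (Fin (k + 1)) => ∫ z, ∏ j ∈ P', Y (f j) z ∂P) univ| ≤ cχ (k + 1) := by
    intro k f
    have h := Literature.MathematicalPhysics.QuantumFieldTheory.Balaban1983to89.B1Eq324BenfattoSect5ChiToOneOnData.abs_ursellOf_tupleSum_mul_sub_le_of_smallFieldData
      (σ := Fin (k + 1)) (s := s) (D := D) (ϰ := κ) (a := a) hα hβ hvar hb0 hγ0 hγ Γ I (shrink L m w) ξ hξ hJI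
      (fun j => T (f j)) (M := M) (fun j => hM (f j)) hχm hχ0 hχ1 hχE
    rw [Fintype.card_fin] at h
    exact h
  -- restate the displayed cluster inputs through the abbreviation `Y`
  have h29Y : ∀ k < t, ∀ f : Fin (k + 1) → Fin 3, (∃ j, f j = 1) → (∃ j, f j = 2) →
      |ursellOf (fun P' : Finset (Fin (k + 1)) => ∫ z, ∏ j ∈ P', Y (f j) z ∂P) univ| ≤ δ₂₉ (k + 1) := h29
  have h31Y : ∀ k < t, ∀ f : Fin (k + 1) → Fin 3, (∃ j, f j = 1) → (∀ j, f j ≠ 2) →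
      |ursellOf (fun P' : Finset (Fin (k + 1)) => ∫ z, ∏ j ∈ P', Y (f j) z ∂P) univ -
        ursellOf (fun P' : Finset (Fin (k + 1)) => ∫ z, ∏ j ∈ P', Y (f j) z ∂P0 d α β) univ| ≤ δ₃₁ (k + 1) := h31
  -- nonnegativity of the χ-removal constant
  have hM0 : 0 ≤ M := (Finset.sum_nonneg fun p _ => Finset.sum_nonneg fun Δ _ => Finset.sum_nonneg fun n _ =>
    mul_nonneg (abs_nonneg _) (Real.exp_pos _).le).trans (hM 0)
  have hcχ0 : ∀ k, 0 ≤ cχ k := fun k => by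
    have h1 : (0 : ℝ) ≤ min 1 (2 * ((shrink L m w).card : ℝ) * Real.exp (-(b ^ 2 / 4))) :=
      le_min zero_le_one (by positivity)
    have h2 : (0 : ℝ) ≤ (1 + (1 + 2 * d / α ^ 2) * (γ * b)) ^ D * M *
        momentConst D (2 * k) (freeCov d α β 0 0).toNNReal := by
      have := one_le_momentConst D (2 * k) (freeCov d α β 0 0).toNNReal
      positivity
    exact mul_nonneg (pow_nonneg (by norm_num) _) (mul_nonneg (Finset.sum_nonneg fun _ _ => Nat.cast_nonneg _)
      (mul_nonneg (Real.rpow_nonneg h1 _) (pow_nonneg h2 _)))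
  -- the generic per-box relation with the per-colouring inputs
  have hmain := Literature.MathematicalPhysics.QuantumFieldTheory.Balaban1983to89.B1Eq324BenfattoSect5PerBox.abs_log_integral_perBox_le_of_colourings
    (μ := P) (Y := Y) (D := fun z => psi3 s D κ a L w v m z) (χ := χ) (K := K) (ε := ε) (W := W) (t := t)
    (δ₂₉ := fun k => cχ k + δ₂₉ k) (δ₃₁ := fun k => cχ k + δ₃₁ k)
    (u₀ := fun n f => ursellOf (fun P' : Finset (Fin n) => ∫ z, ∏ j ∈ P', Y (f j) z ∂P0 d α β) univ)
    hχm hχ0 hχ1 hYm hDm hYK h01K h02K hΨK hDε hε0 hεK hW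
    (fun k => add_nonneg (hcχ0 k) (hδ₂₉ k)) (fun k => add_nonneg (hcχ0 k) (hδ₃₁ k))
    (fun k hk f h1 h2 => by
      have ha := hcχ k f
      have hb' := h29Y k hk f h1 h2
      have htri := abs_sub_abs_le_abs_sub
        (ursellOf (fun P' : Finset (Fin (k + 1)) => ∫ z, ∏ j ∈ P', Y (f j) z * χ z ∂P) univ)
        (ursellOf (fun P' : Finset (Fin (k + 1)) => ∫ z, ∏ j ∈ P', Y (f j) z ∂P) univ)
      show _ ≤ cχ (k + 1) + δ₂₉ (k + 1)
      linarith)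
    (fun k hk f h1 h2 => by
      have ha := hcχ k f
      have hb' := h31Y k hk f h1 h2
      have htri := abs_sub_le
        (ursellOf (fun P' : Finset (Fin (k + 1)) => ∫ z, ∏ j ∈ P', Y (f j) z * χ z ∂P) univ)
        (ursellOf (fun P' : Finset (Fin (k + 1)) => ∫ z, ∏ j ∈ P', Y (f j) z ∂P) univ)
        (ursellOf (fun P' : Finset (Fin (k + 1)) => ∫ z, ∏ j ∈ P', Y (f j) z ∂P0 d α β) univ)
      show _ ≤ cχ (k + 1) + δ₃₁ (k + 1)
      linarith)
  beta_reduce at hmain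
  -- back to print's integrals: `χ e^{Xχ} = 𝟙_S e^{X}`, `X = Ψ_□` resp. `Ψ′₁ + Ψ₂`
  have hset : ∀ (X X' : (B1Eq324BenfattoLemma.Site d → ℝ) → ℝ), (∀ z, X z = X' z) →
      ∫ z, χ z * Real.exp (X z * χ z) ∂P = ∫ z in S, Real.exp (X' z) ∂P := by
    intro X X' hXX'
    rw [Literature.MathematicalPhysics.QuantumFieldTheory.Balaban1983to89.B1Eq324BenfattoSect5PerBox.integral_mul_exp_mul_eq_of_indicator
      hχ01, ← integral_indicator hSm]
    refine integral_congr_ae (ae_of_all _ fun z => ?_)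
    by_cases hz : z ∈ S
    · simp [hχ, hz, hXX' z]
    · simp [hχ, hz]
  have hχm' : AEStronglyMeasurable χ P := hχm.aestronglyMeasurable
  have hposA : 0 < ∫ z, χ z * Real.exp ((Y 0 z + Y 1 z + Y 2 z + psi3 s D κ a L w v m z) * χ z) ∂P :=
    integral_mul_exp_pos hχm hχ0 hχ1 ((((((hYm 0).add (hYm 1)).add (hYm 2)).add hDm).mul hχm').aemeasurable) hΨK hW
  have hposB : 0 < ∫ z, χ z * Real.exp ((Y 0 z + Y 2 z) * χ z) ∂P :=
    integral_mul_exp_pos hχm hχ0 hχ1 ((((hYm 0).add (hYm 2)).mul hχm').aemeasurable) h02K hW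
  rw [hset (fun z => Y 0 z + Y 1 z + Y 2 z + psi3 s D κ a L w v m z) (fun z => psiBox s D κ a L w m z) hsumΨ]
    at hmain hposA
  rw [hset (fun z => Y 0 z + Y 2 z) (fun z => psi1p s D κ a L w v m z + psi2 s D κ a L w m z) hsum02] at hmain hposB
  have hlog : |Real.log lhs - Real.log rhs - E| ≤ Err := hmain
  refine ⟨hposA, hposB, hlog, ?_, ?_⟩
  · have h1 : Real.log rhs + (E - Err) ≤ Real.log lhs := by linarith [(abs_le.1 hlog).1]
    calc Real.exp (E - Err) * rhs = Real.exp (Real.log rhs + (E - Err)) := by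
          rw [Real.exp_add, Real.exp_log hposB, mul_comm]
      _ ≤ Real.exp (Real.log lhs) := Real.exp_le_exp.2 h1
      _ = lhs := Real.exp_log hposA
  · have h1 : Real.log lhs ≤ Real.log rhs + (E + Err) := by linarith [(abs_le.1 hlog).2]
    calc lhs = Real.exp (Real.log lhs) := (Real.exp_log hposA).symm
      _ ≤ Real.exp (Real.log rhs + (E + Err)) := Real.exp_le_exp.2 h1
      _ = Real.exp (E + Err) * rhs := by rw [Real.exp_add, Real.exp_log hposB, mul_comm]

end OnData

end Literature.MathematicalPhysics.QuantumFieldTheory.Balaban1983to89.B1Eq324BenfattoSect5PerBoxOnData
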